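import Summits.Ventures.Crystal3D.Theorems.StickyWulffConstantCoaxialWallLawFaceClasses
import Summits.Ventures.Crystal3D.Theorems.StickyWulffConstantCoaxialWallLawRigidTranslate
import Summits.Ventures.Crystal3D.Theorems.StickyWulffConstantCoaxialWallLawCslTops
import Summits.Ventures.Crystal3D.Theorems.StickyWulffConstantGenericWallFloorCoaxialIff
import HarnessLib

/-!
# The adapted frame of a translation pair (axis rule): the rigid translation rung without axis hypotheses

HONEST FRAMING. Part of the venture `Summits/Ventures/Crystal3D` (cell `crystal3d-full`), helper
`--supports` the crux `CoaxialWallLaw` (stmt-Ventures-19481, `route-Ventures-StickyWulffConstant`),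
REGISTERED line `WallLedgerF` (planner cf-p1 gen 16), stub `stub_coaxialTwoSlabAdhesion`.
RUNG CREDIT ONLY.

The rigid translation rung `coaxialTwoSlabAdhesion_rigid_translate` (`…RigidTranslate`) carries the
AXIS-RULE hypotheses: no lateral face class `(2/3)(w₁+w₂+w₃)` (face with a horizontal vertex
`w₁`) is congruent mod `Λ₀` to the pulled-back offset `d = L⁻¹(s₂ − s₁)` (resp. `−d`).  This file
discharges them by CHOOSING THE FRAME (line card WallLedger.md, addendum A): if the frame `L`
violates the rule at a lateral face `T₀`, then the bond mirror `g ∈ {r_t, r_{u−t}, r_{v−t}}`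
(`…CubicActions`) that turns the `⟨111⟩` axis of `T₀` into the basal axis gives a frame `L ∘ g` of
the SAME lattice satisfying the rule: a violating lateral face `T` of `L ∘ g` would have
`(2/3)(g ΣT − ΣT₀) ∈ Λ₀`, hence (cubic coordinates, face sums `2ε`) `g ΣT = ΣT₀`, i.e. `ΣT` basal —
impossible for a lateral face (`faceSum_not_vertical`).

* `exists_adapted_mirror` — the frame choice;
* `coaxialTwoSlabAdhesion_rigid_translatePair` — **for every co-axial pair with the SAME linear
  lattice (`A₁·Λ₀ = A₂·Λ₀`, translation pair) and disjoint grains, there is a co-axial frame `L'` in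
  which the conclusion of `CoaxialTwoSlabAdhesion` holds for every RIGID filling** (`R₀ = 3`).
  With `coaxialTwoSlabAdhesion_rigid_twinPair` (`…CslRigidTwinStub`) this is the rigid rung of the
  stub for EVERY co-axial pair of distinct moved fcc lattices.

WHAT THIS IS NOT: the stub (arbitrary fillings); rung F-C1 not moved.
-/

noncomputable section

namespace Summit.Ventures.Crystal3D.Theorems

open Summit.Ventures.Crystal3D Finset
open Literature.MathematicalPhysics.StatisticalMechanics (barlowPos barlowStacking fccStacking
  constHagg IsHaggSeq isHaggSeq_const barlowPos_mem contactDeficiency)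
open scoped InnerProductSpace

/-- **The frame choice.**  If the axis rule fails for the offset `d` at a lateral face `T₀`, some
bond mirror `g` of `Λ₀` (a lattice isometry with `g ∘ g = id`) makes it hold for `g d`. -/
theorem exists_adapted_mirror (d : EuclideanSpace ℝ (Fin 3))
    {w₁ w₂ w₃ : EuclideanSpace ℝ (Fin 3)} (h₁ : w₁ ∈ fccSlots) (h₂ : w₂ ∈ fccSlots) (h₃ : w₃ ∈ fccSlots)
    (d12 : dist w₁ w₂ = 1) (d13 : dist w₁ w₃ = 1) (d23 : dist w₂ w₃ = 1) (hw₁ : w₁ 2 = 0)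
    (hbad : (2 / 3 : ℝ) • (w₁ + w₂ + w₃) - d ∈ fccStacking 1 (Real.sqrt (2 / 3))) :
    ∃ g : EuclideanSpace ℝ (Fin 3) ≃ₗᵢ[ℝ] EuclideanSpace ℝ (Fin 3),
      (∀ p ∈ fccStacking 1 (Real.sqrt (2 / 3)), g p ∈ fccStacking 1 (Real.sqrt (2 / 3))) ∧
      (∀ p, g (g p) = p) ∧
      ∀ v₁ ∈ fccSlots, ∀ v₂ ∈ fccSlots, ∀ v₃ ∈ fccSlots,
        dist v₁ v₂ = 1 → dist v₁ v₃ = 1 → dist v₂ v₃ = 1 → v₁ 2 = 0 →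
        (2 / 3 : ℝ) • (v₁ + v₂ + v₃) - g d ∉ fccStacking 1 (Real.sqrt (2 / 3)) := by
  -- cubic coordinates
  set A : EuclideanSpace ℝ (Fin 3) → ℝ := fun x => x 0 + Real.sqrt 3 / 3 * x 1 - Real.sqrt (2 / 3) * x 2
    with hAdef
  set B : EuclideanSpace ℝ (Fin 3) → ℝ := fun x => x 0 - Real.sqrt 3 / 3 * x 1 + Real.sqrt (2 / 3) * x 2
    with hBdef
  set C : EuclideanSpace ℝ (Fin 3) → ℝ := fun x => 2 * Real.sqrt 3 / 3 * x 1 + Real.sqrt (2 / 3) * x 2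
    with hCdef
  have hA : ∀ x, A x = x 0 + Real.sqrt 3 / 3 * x 1 - Real.sqrt (2 / 3) * x 2 := fun x => rfl
  have hB : ∀ x, B x = x 0 - Real.sqrt 3 / 3 * x 1 + Real.sqrt (2 / 3) * x 2 := fun x => rfl
  have hC : ∀ x, C x = 2 * Real.sqrt 3 / 3 * x 1 + Real.sqrt (2 / 3) * x 2 := fun x => rfl
  have hlin : ∀ (F : EuclideanSpace ℝ (Fin 3) → ℝ) (a b c : ℝ),
      (∀ x, F x = a * x 0 + b * x 1 + c * x 2) → ∀ (r : ℝ) x y, F (r • (x - y)) = r * (F x - F y) := by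
    intro F a b c hF r x y
    rw [hF, hF, hF]; simp only [PiLp.smul_apply, PiLp.sub_apply, smul_eq_mul]; ring
  have hAl : ∀ (r : ℝ) x y, A (r • (x - y)) = r * (A x - A y) :=
    hlin A 1 (Real.sqrt 3 / 3) (-Real.sqrt (2 / 3)) (fun x => by rw [hA]; ring)
  have hBl : ∀ (r : ℝ) x y, B (r • (x - y)) = r * (B x - B y) :=
    hlin B 1 (-(Real.sqrt 3 / 3)) (Real.sqrt (2 / 3)) (fun x => by rw [hB]; ring)
  have hCl : ∀ (r : ℝ) x y, C (r • (x - y)) = r * (C x - C y) :=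
    hlin C 0 (2 * Real.sqrt 3 / 3) (Real.sqrt (2 / 3)) (fun x => by rw [hC]; ring)
  -- the three mirrors and their actions
  obtain ⟨-, -, ⟨htΛ, htn⟩, -, ⟨hutΛ, hutn⟩, ⟨hvtΛ, hvtn⟩⟩ := bond_mem_and_norm
  set t : EuclideanSpace ℝ (Fin 3) := barlowPos 1 (Real.sqrt (2 / 3)) constHagg 1 0 0 with ht
  set u : EuclideanSpace ℝ (Fin 3) := barlowPos 1 (Real.sqrt (2 / 3)) constHagg 0 1 0 with hu
  set v : EuclideanSpace ℝ (Fin 3) := barlowPos 1 (Real.sqrt (2 / 3)) constHagg 0 0 1 with hv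
  have hact := fun x => cubic_actions A B C hA hB hC x
  -- the two facts about integers: `(2/3)(x − a) ∈ ℤ` with `x, a ∈ {±2}` forces `x = a`
  have hint : ∀ x a : ℝ, (x = 2 ∨ x = -2) → (a = 2 ∨ a = -2) → (∃ m : ℤ, 2 / 3 * (x - a) = m) → x = a := by
    rintro x a hx ha ⟨m, hm⟩
    rcases hx with rfl | rfl <;> rcases ha with rfl | rfl
    · rfl
    · exfalso
      have : (3 : ℝ) * m = 8 := by linarith
      have h3 : (3 : ℤ) * m = 8 := by exact_mod_cast this
      omega
    · exfalso
      have : (3 : ℝ) * m = -8 := by linarith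
      have h3 : (3 : ℤ) * m = -8 := by exact_mod_cast this
      omega
    · rfl
  -- face sum of `T₀`
  obtain ⟨ha₀, hb₀, hc₀⟩ := faceSum_cubic A B C hA hB hC h₁ h₂ h₃ d12 d13 d23
  have hnv₀ := faceSum_not_vertical A B C hA hB hC h₂ h₃ hw₁
  set S₀ := w₁ + w₂ + w₃ with hS₀
  -- generic contradiction engine: a lattice isometry `g` with `g ∘ g = id` whose cubic action sends
  -- only the basal classes `±(−2, 2, 2)` to the class of `S₀` admits no violating lateral face.
  have engine : ∀ g : EuclideanSpace ℝ (Fin 3) ≃ₗᵢ[ℝ] EuclideanSpace ℝ (Fin 3),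
      (∀ p ∈ fccStacking 1 (Real.sqrt (2 / 3)), g p ∈ fccStacking 1 (Real.sqrt (2 / 3))) →
      (∀ p, g (g p) = p) →
      (∀ x, A (g x) = A S₀ → B (g x) = B S₀ → C (g x) = C S₀ →
        (A x = -2 * 1 ∧ B x = 2 * 1 ∧ C x = 2 * 1) ∨ (A x = -2 * (-1) ∧ B x = 2 * (-1) ∧ C x = 2 * (-1))) →
      ∀ v₁ ∈ fccSlots, ∀ v₂ ∈ fccSlots, ∀ v₃ ∈ fccSlots,
        dist v₁ v₂ = 1 → dist v₁ v₃ = 1 → dist v₂ v₃ = 1 → v₁ 2 = 0 →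
        (2 / 3 : ℝ) • (v₁ + v₂ + v₃) - g d ∉ fccStacking 1 (Real.sqrt (2 / 3)) := by
    intro g hgΛ hgg hpre v₁ hv₁ v₂ hv₂ v₃ hv₃ e12 e13 e23 hv₁0 hmem
    set S := v₁ + v₂ + v₃ with hS
    -- apply `g`: `(2/3) g S − d ∈ Λ₀`
    have h1 : (2 / 3 : ℝ) • g S - d ∈ fccStacking 1 (Real.sqrt (2 / 3)) := by
      have := hgΛ _ hmem
      rw [map_sub, LinearIsometryEquiv.map_smul, hgg] at this
      exact this
    -- subtract the `T₀` relation
    have h2 : (2 / 3 : ℝ) • (g S - S₀) ∈ fccStacking 1 (Real.sqrt (2 / 3)) := by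
      have := fcc_sub_site_mem h1 hbad
      have e : (2 / 3 : ℝ) • g S - d - ((2 / 3 : ℝ) • S₀ - d) = (2 / 3 : ℝ) • (g S - S₀) := by
        rw [smul_sub]; abel
      rw [e] at this; exact this
    obtain ⟨a, b, c, ha, hb, hc⟩ := cubic_int_of_mem_fcc A B C hA hB hC h2
    rw [hAl] at ha; rw [hBl] at hb; rw [hCl] at hc
    -- `g S = g v₁ + g v₂ + g v₃` is a face sum: cubic coordinates `±2`
    have hgv : ∀ {w}, w ∈ fccSlots → g w ∈ fccSlots := by
      intro w hw
      exact mem_fccSlots_of_unit (hgΛ _ (mem_fcc_of_mem_fccSlots hw))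
        (by rw [LinearIsometryEquiv.norm_map, norm_eq_one_of_mem_fccSlots hw])
    have hAx : (A (g S) = 2 ∨ A (g S) = -2) ∧ (B (g S) = 2 ∨ B (g S) = -2) ∧
        (C (g S) = 2 ∨ C (g S) = -2) := by
      have e : g S = g v₁ + g v₂ + g v₃ := by rw [hS, map_add, map_add]
      rw [e]
      exact faceSum_cubic A B C hA hB hC (hgv hv₁) (hgv hv₂) (hgv hv₃)
        (by rw [LinearIsometryEquiv.dist_map]; exact e12) (by rw [LinearIsometryEquiv.dist_map]; exact e13)
        (by rw [LinearIsometryEquiv.dist_map]; exact e23)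
    have eqA : A (g S) = A S₀ := hint _ _ hAx.1 ha₀ ⟨a, ha⟩
    have eqB : B (g S) = B S₀ := hint _ _ hAx.2.1 hb₀ ⟨b, hb⟩
    have eqC : C (g S) = C S₀ := hint _ _ hAx.2.2 hc₀ ⟨c, hc⟩
    have hnv := faceSum_not_vertical A B C hA hB hC hv₂ hv₃ hv₁0
    rcases hpre S eqA eqB eqC with hS1 | hS2
    · exact hnv 1 (Or.inl rfl) hS1
    · exact hnv (-1) (Or.inr rfl) hS2
  -- lattice-isometry / involution facts for the three mirrors
  have hmirror : ∀ {w : EuclideanSpace ℝ (Fin 3)}, w ∈ fccStacking 1 (Real.sqrt (2 / 3)) → ‖w‖ = 1 →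
      (∀ p ∈ fccStacking 1 (Real.sqrt (2 / 3)), (ℝ ∙ w)ᗮ.reflection p ∈ fccStacking 1 (Real.sqrt (2 / 3))) ∧
      (∀ p, (ℝ ∙ w)ᗮ.reflection ((ℝ ∙ w)ᗮ.reflection p) = p) :=
    fun hw hw1 => ⟨fun p hp => bondReflection_mem_fcc hw hw1 hp, fun p => Submodule.reflection_reflection _ p⟩
  -- case analysis on the class `(A S₀, B S₀, C S₀) = 2ε`, `ε ≠ ±(−1, 1, 1)`
  rcases ha₀ with ha | ha <;> rcases hb₀ with hb | hb <;> rcases hc₀ with hc | hc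
  · -- (2,2,2): r_t ↦ (A, −C, −B)
    refine ⟨(ℝ ∙ t)ᗮ.reflection, (hmirror htΛ htn).1, (hmirror htΛ htn).2, engine _ (hmirror htΛ htn).1
      (hmirror htΛ htn).2
      ?_⟩
    · intro x eA eB eC
      obtain ⟨a1, a2, a3⟩ := (hact x).2.2.1
      rw [a1] at eA; rw [a2] at eB; rw [a3] at eC
      right; refine ⟨?_, ?_, ?_⟩ <;> linarith
  · -- (2,2,-2): r_{u−t} ↦ (C, B, A)
    refine ⟨(ℝ ∙ (u - t))ᗮ.reflection, (hmirror hutΛ hutn).1, (hmirror hutΛ hutn).2,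
      engine _ (hmirror hutΛ hutn).1 (hmirror hutΛ hutn).2
      ?_⟩
    · intro x eA eB eC
      obtain ⟨a1, a2, a3⟩ := (hact x).2.2.2.2.1
      rw [a1] at eA; rw [a2] at eB; rw [a3] at eC
      left; refine ⟨?_, ?_, ?_⟩ <;> linarith
  · -- (2,-2,2): r_{v−t} ↦ (B, A, C)
    refine ⟨(ℝ ∙ (v - t))ᗮ.reflection, (hmirror hvtΛ hvtn).1, (hmirror hvtΛ hvtn).2,
      engine _ (hmirror hvtΛ hvtn).1 (hmirror hvtΛ hvtn).2
      ?_⟩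
    · intro x eA eB eC
      obtain ⟨a1, a2, a3⟩ := (hact x).2.2.2.2.2.1
      rw [a1] at eA; rw [a2] at eB; rw [a3] at eC
      left; refine ⟨?_, ?_, ?_⟩ <;> linarith
  · -- (2,-2,-2) = -(−2,2,2): excluded
    exact (hnv₀ (-1) (Or.inr rfl) ⟨by linarith, by linarith, by linarith⟩).elim
  · -- (-2,2,2): excluded
    exact (hnv₀ 1 (Or.inl rfl) ⟨by linarith, by linarith, by linarith⟩).elim
  · -- (-2,2,-2) = -(2,-2,2): r_{v−t}
    refine ⟨(ℝ ∙ (v - t))ᗮ.reflection, (hmirror hvtΛ hvtn).1, (hmirror hvtΛ hvtn).2,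
      engine _ (hmirror hvtΛ hvtn).1 (hmirror hvtΛ hvtn).2
      ?_⟩
    · intro x eA eB eC
      obtain ⟨a1, a2, a3⟩ := (hact x).2.2.2.2.2.1
      rw [a1] at eA; rw [a2] at eB; rw [a3] at eC
      right; refine ⟨?_, ?_, ?_⟩ <;> linarith
  · -- (-2,-2,2) = -(2,2,-2): r_{u−t}
    refine ⟨(ℝ ∙ (u - t))ᗮ.reflection, (hmirror hutΛ hutn).1, (hmirror hutΛ hutn).2,
      engine _ (hmirror hutΛ hutn).1 (hmirror hutΛ hutn).2
      ?_⟩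
    · intro x eA eB eC
      obtain ⟨a1, a2, a3⟩ := (hact x).2.2.2.2.1
      rw [a1] at eA; rw [a2] at eB; rw [a3] at eC
      right; refine ⟨?_, ?_, ?_⟩ <;> linarith
  · -- (-2,-2,-2): r_t
    refine ⟨(ℝ ∙ t)ᗮ.reflection, (hmirror htΛ htn).1, (hmirror htΛ htn).2, engine _ (hmirror htΛ htn).1
      (hmirror htΛ htn).2
      ?_⟩
    · intro x eA eB eC
      obtain ⟨a1, a2, a3⟩ := (hact x).2.2.1
      rw [a1] at eA; rw [a2] at eB; rw [a3] at eC
      left; refine ⟨?_, ?_, ?_⟩ <;> linarith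

/-- **An adapted frame exists.**  For grains `L₀·Λ₀ + s₁`, `L₀·Λ₀ + s₂` there is a frame `L'` of
the same lattice (`L'·Λ₀ + sᵢ = L₀·Λ₀ + sᵢ`) satisfying both axis-rule hypotheses of
`coaxialTwoSlabAdhesion_rigid_translate`. -/
theorem exists_adapted_frame
    (L₀ : EuclideanSpace ℝ (Fin 3) ≃ₗᵢ[ℝ] EuclideanSpace ℝ (Fin 3)) (s₁ s₂ : EuclideanSpace ℝ (Fin 3)) :
    ∃ L' : EuclideanSpace ℝ (Fin 3) ≃ₗᵢ[ℝ] EuclideanSpace ℝ (Fin 3),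
      (fun q => L' q + s₁) '' fccStacking 1 (Real.sqrt (2 / 3)) =
        (fun q => L₀ q + s₁) '' fccStacking 1 (Real.sqrt (2 / 3)) ∧
      (fun q => L' q + s₂) '' fccStacking 1 (Real.sqrt (2 / 3)) =
        (fun q => L₀ q + s₂) '' fccStacking 1 (Real.sqrt (2 / 3)) ∧
      (∀ w₁ ∈ fccSlots, ∀ w₂ ∈ fccSlots, ∀ w₃ ∈ fccSlots,
        dist w₁ w₂ = 1 → dist w₁ w₃ = 1 → dist w₂ w₃ = 1 → w₁ 2 = 0 →
        (2 / 3 : ℝ) • (w₁ + w₂ + w₃) - L'.symm (s₂ - s₁) ∉ fccStacking 1 (Real.sqrt (2 / 3))) ∧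
      (∀ w₁ ∈ fccSlots, ∀ w₂ ∈ fccSlots, ∀ w₃ ∈ fccSlots,
        dist w₁ w₂ = 1 → dist w₁ w₃ = 1 → dist w₂ w₃ = 1 → w₁ 2 = 0 →
        (2 / 3 : ℝ) • (w₁ + w₂ + w₃) - L'.symm (s₁ - s₂) ∉ fccStacking 1 (Real.sqrt (2 / 3))) := by
  -- from the axis rule for `d` to both hypotheses (the second via the antipodal face)
  have both : ∀ (L' : EuclideanSpace ℝ (Fin 3) ≃ₗᵢ[ℝ] EuclideanSpace ℝ (Fin 3)) (d : EuclideanSpace ℝ (Fin 3)),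
      L'.symm (s₂ - s₁) = d →
      (∀ w₁ ∈ fccSlots, ∀ w₂ ∈ fccSlots, ∀ w₃ ∈ fccSlots,
        dist w₁ w₂ = 1 → dist w₁ w₃ = 1 → dist w₂ w₃ = 1 → w₁ 2 = 0 →
        (2 / 3 : ℝ) • (w₁ + w₂ + w₃) - d ∉ fccStacking 1 (Real.sqrt (2 / 3))) →
      (∀ w₁ ∈ fccSlots, ∀ w₂ ∈ fccSlots, ∀ w₃ ∈ fccSlots,
        dist w₁ w₂ = 1 → dist w₁ w₃ = 1 → dist w₂ w₃ = 1 → w₁ 2 = 0 →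
        (2 / 3 : ℝ) • (w₁ + w₂ + w₃) - L'.symm (s₂ - s₁) ∉ fccStacking 1 (Real.sqrt (2 / 3))) ∧
      (∀ w₁ ∈ fccSlots, ∀ w₂ ∈ fccSlots, ∀ w₃ ∈ fccSlots,
        dist w₁ w₂ = 1 → dist w₁ w₃ = 1 → dist w₂ w₃ = 1 → w₁ 2 = 0 →
        (2 / 3 : ℝ) • (w₁ + w₂ + w₃) - L'.symm (s₁ - s₂) ∉ fccStacking 1 (Real.sqrt (2 / 3))) := by
    intro L' d hd hax
    refine ⟨fun w₁ h₁ w₂ h₂ w₃ h₃ d12 d13 d23 hw => by rw [hd]; exact hax w₁ h₁ w₂ h₂ w₃ h₃ d12 d13 d23 hw,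
      fun w₁ h₁ w₂ h₂ w₃ h₃ d12 d13 d23 hw hmem => ?_⟩
    have hneg : L'.symm (s₁ - s₂) = -d := by rw [← hd, ← map_neg, neg_sub]
    have key := hax (-w₁) (neg_mem_fccSlots h₁) (-w₂) (neg_mem_fccSlots h₂) (-w₃) (neg_mem_fccSlots h₃)
      (by rw [dist_neg_neg]; exact d12) (by rw [dist_neg_neg]; exact d13) (by rw [dist_neg_neg]; exact d23)
      (by rw [PiLp.neg_apply, hw, neg_zero])
    apply key
    have e : (2 / 3 : ℝ) • (-w₁ + -w₂ + -w₃) - d = -((2 / 3 : ℝ) • (w₁ + w₂ + w₃) - L'.symm (s₁ - s₂)) := by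
      rw [hneg, smul_add, smul_add, smul_add, smul_add, smul_neg, smul_neg, smul_neg]; abel
    rw [e]
    exact fcc_neg_mem hmem
  set d := L₀.symm (s₂ - s₁) with hd
  by_cases hax : ∀ w₁ ∈ fccSlots, ∀ w₂ ∈ fccSlots, ∀ w₃ ∈ fccSlots,
      dist w₁ w₂ = 1 → dist w₁ w₃ = 1 → dist w₂ w₃ = 1 → w₁ 2 = 0 →
      (2 / 3 : ℝ) • (w₁ + w₂ + w₃) - d ∉ fccStacking 1 (Real.sqrt (2 / 3))
  · exact ⟨L₀, rfl, rfl, both L₀ d rfl hax⟩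
  · push Not at hax
    obtain ⟨w₁, h₁, w₂, h₂, w₃, h₃, d12, d13, d23, hw₁, hbad⟩ := hax
    obtain ⟨g, hgΛ, hgg, hgood⟩ := exists_adapted_mirror d h₁ h₂ h₃ d12 d13 d23 hw₁ hbad
    refine ⟨g.trans L₀, ?_, ?_, both (g.trans L₀) (g d) ?_ hgood⟩
    · ext x
      simp only [Set.mem_image, LinearIsometryEquiv.trans_apply]
      constructor
      · rintro ⟨q, hq, rfl⟩; exact ⟨g q, hgΛ q hq, rfl⟩
      · rintro ⟨q, hq, rfl⟩; exact ⟨g q, hgΛ q hq, by rw [hgg]⟩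
    · ext x
      simp only [Set.mem_image, LinearIsometryEquiv.trans_apply]
      constructor
      · rintro ⟨q, hq, rfl⟩; exact ⟨g q, hgΛ q hq, rfl⟩
      · rintro ⟨q, hq, rfl⟩; exact ⟨g q, hgΛ q hq, by rw [hgg]⟩
    · rw [LinearIsometryEquiv.symm_trans, LinearIsometryEquiv.trans_apply, ← hd]
      apply g.injective
      rw [LinearIsometryEquiv.apply_symm_apply, hgg]

/-- **The rigid rung of `stub_coaxialTwoSlabAdhesion` for translation pairs, in an ADAPTED frame.**
See the module docstring. -/
theorem coaxialTwoSlabAdhesion_rigid_translatePair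
    (A₁ : EuclideanSpace ℝ (Fin 3) ≃ₗᵢ[ℝ] EuclideanSpace ℝ (Fin 3)) (t₁ : EuclideanSpace ℝ (Fin 3))
    (A₂ : EuclideanSpace ℝ (Fin 3) ≃ₗᵢ[ℝ] EuclideanSpace ℝ (Fin 3)) (t₂ : EuclideanSpace ℝ (Fin 3))
    (hcoax : ∃ (L : EuclideanSpace ℝ (Fin 3) ≃ₗᵢ[ℝ] EuclideanSpace ℝ (Fin 3))
        (s₁ s₂ : EuclideanSpace ℝ (Fin 3)) (σ σ' : ℤ → ℤ), IsHaggSeq σ ∧ IsHaggSeq σ' ∧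
        (fun p => A₁ p + t₁) '' fccStacking 1 (Real.sqrt (2 / 3)) ⊆
          (fun p => L p + s₁) '' barlowStacking 1 (Real.sqrt (2 / 3)) σ ∧
        (fun p => A₂ p + t₂) '' fccStacking 1 (Real.sqrt (2 / 3)) ⊆
          (fun p => L p + s₂) '' barlowStacking 1 (Real.sqrt (2 / 3)) σ')
    (hsame : A₁ '' fccStacking 1 (Real.sqrt (2 / 3)) = A₂ '' fccStacking 1 (Real.sqrt (2 / 3)))
    (hdisj : ∀ p ∈ (fun q => A₁ q + t₁) '' fccStacking 1 (Real.sqrt (2 / 3)),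
      p ∉ (fun q => A₂ q + t₂) '' fccStacking 1 (Real.sqrt (2 / 3))) :
    ∃ (L : EuclideanSpace ℝ (Fin 3) ≃ₗᵢ[ℝ] EuclideanSpace ℝ (Fin 3))
        (s₁ s₂ : EuclideanSpace ℝ (Fin 3)) (σ σ' : ℤ → ℤ), IsHaggSeq σ ∧ IsHaggSeq σ' ∧
        (fun p => A₁ p + t₁) '' fccStacking 1 (Real.sqrt (2 / 3)) ⊆
          (fun p => L p + s₁) '' barlowStacking 1 (Real.sqrt (2 / 3)) σ ∧
        (fun p => A₂ p + t₂) '' fccStacking 1 (Real.sqrt (2 / 3)) ⊆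
          (fun p => L p + s₂) '' barlowStacking 1 (Real.sqrt (2 / 3)) σ' ∧
    ∃ C R₀ : ℝ, 1 ≤ R₀ ∧ ∀ h : ℝ, 0 ≤ h → ∀ ρ : ℝ, R₀ ≤ ρ →
      ∀ X P₁ P₂ : Finset (EuclideanSpace ℝ (Fin 3)),
      (∀ p ∈ X, ∀ q ∈ X, p ≠ q → 1 ≤ dist p q) → P₁ ⊆ X → P₂ ⊆ X \ P₁ →
      (∀ p ∈ X, -(2 * R₀) ≤ p 2 ∧ p 2 ≤ h + 2 * R₀ ∧ p 0 ^ 2 + p 1 ^ 2 ≤ ρ ^ 2) →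
      (∀ p, p ∈ P₁ ↔ (p ∈ (fun q => A₁ q + t₁) '' fccStacking 1 (Real.sqrt (2 / 3)) ∧
        -(2 * R₀) ≤ p 2 ∧ p 2 ≤ -R₀ ∧ p 0 ^ 2 + p 1 ^ 2 ≤ ρ ^ 2)) →
      (∀ p, p ∈ P₂ ↔ (p ∈ (fun q => A₂ q + t₂) '' fccStacking 1 (Real.sqrt (2 / 3)) ∧
        h + R₀ ≤ p 2 ∧ p 2 ≤ h + 2 * R₀ ∧ p 0 ^ 2 + p 1 ^ 2 ≤ ρ ^ 2)) →
      (∀ p ∈ X, p ∈ (fun q => A₁ q + t₁) '' fccStacking 1 (Real.sqrt (2 / 3)) ∨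
        p ∈ (fun q => A₂ q + t₂) '' fccStacking 1 (Real.sqrt (2 / 3))) →
      ((((P₁ ×ˢ (X \ P₁)).filter fun pq => dist pq.1 pq.2 = 1).card : ℕ) : ℝ) +
        ((((P₂ ×ˢ ((X \ P₁) \ P₂)).filter fun pq => dist pq.1 pq.2 = 1).card : ℕ) : ℝ) ≤
        contactDeficiency ((X \ P₁) \ P₂) +
          (Real.sqrt 2 / 4 * ∑ᶠ w ∈ {w ∈ fccStacking 1 (Real.sqrt (2 / 3)) | ‖w‖ = 1},
              |⟪w, A₁.symm (EuclideanSpace.single (2 : Fin 3) (1 : ℝ))⟫_ℝ| +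
            Real.sqrt 2 / 4 * ∑ᶠ w ∈ {w ∈ fccStacking 1 (Real.sqrt (2 / 3)) | ‖w‖ = 1},
              |⟪w, A₂.symm (EuclideanSpace.single (2 : Fin 3) (1 : ℝ))⟫_ℝ| -
            (1 / 2 : ℝ) * Real.sqrt (1 - ⟪L (EuclideanSpace.single (2 : Fin 3) (1 : ℝ)),
              (EuclideanSpace.single (2 : Fin 3) (1 : ℝ))⟫_ℝ ^ 2)) * Real.pi * ρ ^ 2 +
          C * (1 + h) * ρ := by
  obtain ⟨L, s₁, s₂, σ, σ', hσ, hσ', hsub₁, hsub₂⟩ := hcoax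
  set R := (ℝ ∙ EuclideanSpace.single (2 : Fin 3) (1 : ℝ)).reflection with hR
  -- same letter at `0`: otherwise the linear lattices differ
  have e₁ := (linear_image_eq_frame_of_subset A₁ L t₁ s₁ hσ hsub₁).2
  have e₂ := (linear_image_eq_frame_of_subset A₂ L t₂ s₂ hσ' hsub₂).2
  have hne : L '' fccStacking 1 (Real.sqrt (2 / 3)) ≠
      L '' barlowStacking 1 (Real.sqrt (2 / 3)) (fun _ : ℤ => (-1 : ℤ)) := by
    intro h
    have ht : L (barlowPos 1 (Real.sqrt (2 / 3)) constHagg 1 0 0) ∈ L '' fccStacking 1 (Real.sqrt (2 / 3)) :=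
      ⟨_, barlowPos_mem _ _ _, rfl⟩
    rw [h] at ht
    obtain ⟨q, hq, hqe⟩ := ht
    rw [L.injective hqe] at hq
    have := (mem_twin_iff_three_dvd 1 0 0).1 hq
    omega
  have hfcc : barlowStacking 1 (Real.sqrt (2 / 3)) (fun _ : ℤ => (1 : ℤ)) = fccStacking 1 (Real.sqrt (2 / 3)) := rfl
  -- a frame `L₀` presenting BOTH grains as translates of `L₀·Λ₀`
  have hframe : ∃ L₀ : EuclideanSpace ℝ (Fin 3) ≃ₗᵢ[ℝ] EuclideanSpace ℝ (Fin 3),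
      (fun q => A₁ q + t₁) '' fccStacking 1 (Real.sqrt (2 / 3)) =
        (fun q => L₀ q + s₁) '' fccStacking 1 (Real.sqrt (2 / 3)) ∧
      (fun q => A₂ q + t₂) '' fccStacking 1 (Real.sqrt (2 / 3)) =
        (fun q => L₀ q + s₂) '' fccStacking 1 (Real.sqrt (2 / 3)) := by
    rcases hσ 0 with h1 | hm1 <;> rcases hσ' 0 with h1' | hm1'
    · exact ⟨L, coaxial_frame_eq_fcc_of_one A₁ t₁ L s₁ hσ hsub₁ h1,
        coaxial_frame_eq_fcc_of_one A₂ t₂ L s₂ hσ' hsub₂ h1'⟩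
    · exfalso; apply hne
      rw [h1, hfcc] at e₁; rw [hm1'] at e₂
      rw [← e₁, ← e₂]; exact hsame
    · exfalso; apply hne
      rw [hm1] at e₁; rw [h1', hfcc] at e₂
      rw [← e₁, ← e₂]; exact hsame.symm
    · exact ⟨R.trans L, (coaxial_frame_eq_fcc_of_neg_one A₁ t₁ L s₁ hσ hsub₁ hm1).1,
        (coaxial_frame_eq_fcc_of_neg_one A₂ t₂ L s₂ hσ' hsub₂ hm1').1⟩
  obtain ⟨L₀, hg₁, hg₂⟩ := hframe
  obtain ⟨L', hL'₁, hL'₂, hax, hax'⟩ := exists_adapted_frame L₀ s₁ s₂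
  have hsub₁' : (fun p => A₁ p + t₁) '' fccStacking 1 (Real.sqrt (2 / 3)) ⊆
      (fun p => L' p + s₁) '' barlowStacking 1 (Real.sqrt (2 / 3)) constHagg := by
    rw [hg₁, ← hL'₁]; exact subset_rfl
  have hsub₂' : (fun p => A₂ p + t₂) '' fccStacking 1 (Real.sqrt (2 / 3)) ⊆
      (fun p => L' p + s₂) '' barlowStacking 1 (Real.sqrt (2 / 3)) constHagg := by
    rw [hg₂, ← hL'₂]; exact subset_rfl
  obtain ⟨C, R₀, hR₀, hmain⟩ := coaxialTwoSlabAdhesion_rigid_translate A₁ t₁ A₂ t₂ L' s₁ s₂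
    isHaggSeq_const isHaggSeq_const rfl rfl hsub₁' hsub₂' hdisj hax hax'
  exact ⟨L', s₁, s₂, constHagg, constHagg, isHaggSeq_const, isHaggSeq_const, hsub₁', hsub₂', C, R₀, hR₀, hmain⟩

end Summit.Ventures.Crystal3D.Theorems

end
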